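import Mathlib.Analysis.SpecialFunctions.Pow.Asymptotics
import Mathlib.NumberTheory.Harmonic.Bounds
import Literature.NumberTheory.LFunctions.NicolasMertensRH
import Literature.NumberTheory.LFunctions.RobinCriterion
import HarnessLib

/-!
# Robin's criterion, converse half: `¬RH ⟹` Robin's inequality fails (Robin 1984, §4)

Topic: `Literature/NumberTheory/LFunctions`. Pure proof file (no definition, nothing asserted),
serving provefact `Literature.NumberTheory.LFunctions.robin_iff`. Robin (1984, §4, Prop. 1) proves that if RH is false then
`σ(n)/(n log log n) = e^γ (1 + Ω_±((log n)^{−b}))`, transferring to `σ(n)/n` at colossally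
abundant numbers the oscillation theorem of Nicolas (1983) for
`f(x) = e^γ log θ(x) ∏_{p≤x}(1 − 1/p)`: "if RH fails, `log f(x) = Ω_±(x^{−b})` for some
`0 < b < 1/2`" (`Literature.NumberTheory.LFunctions.Nicolas1983_logf_omega`, as restated in Nicolas 2012, (1.10)).

Here we prove the consequence that closes Robin's criterion:

* `Literature.NumberTheory.LFunctions.robinInequality_imp_riemannHypothesis_of_nicolas` — granted
  `Nicolas1983_logf_omega`, if `σ(n) < e^γ n log log n` for every `n > 5040` then RH holds.

Instead of colossally abundant numbers we use `N = lcm(1, …, ⌊x⌋)` (`Nat.lcmUpto`, with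
`log N = ψ(x)`): if `log f(x) ≤ −c x^{−b}` then
`σ(N)/N = ∏_{p≤x}(1 − p^{−a_p−1})(1 − 1/p)⁻¹ ≥ (1 − (1 + log x)/√x) · e^γ log θ(x) · e^{c x^{−b}}`
(each `p^{a_p+1} > x` and `≥ p²`, so `∑_p p^{−a_p−1} ≤ ∑_{p≤x} 1/(p√x) ≤ (1 + log x)/√x`), while
`e^γ log log N = e^γ log ψ(x) ≤ e^γ (log θ(x) + 2√x log x/θ(x))` (Mathlib's
`Chebyshev.psi_sub_theta_le`); since `b < 1/2` the gain `c x^{−b}` beats both losses for large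
`x`, and `x` may be taken arbitrarily large (`Ω₋`), so `N > 5040` violates Robin's inequality.

## References

* G. Robin, J. Math. Pures Appl. 63 (1984), 187–213, §4, Prop. 1. [Robin1984]
* J.-L. Nicolas, J. Number Theory 17 (1983), 375–388 (the `Ω_±` theorem); Acta Arith. 155
  (2012), (1.10). [Nicolas1983] [Nicolas2012]
-/

noncomputable section

open Real Filter Finset Asymptotics
open scoped Chebyshev ArithmeticFunction.sigma Topology

namespace Literature.NumberTheory.LFunctions

namespace RobinOscillation

/-! ### `σ(N)/N` for `N = lcm(1, …, n)` -/

/-- Weierstrass: `1 − ∑ aᵢ ≤ ∏ (1 − aᵢ)` for `0 ≤ aᵢ ≤ 1`. [folklore] -/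
theorem one_sub_sum_le_prod {ι : Type*} (s : Finset ι) (a : ι → ℝ)
    (h0 : ∀ i ∈ s, 0 ≤ a i) (h1 : ∀ i ∈ s, a i ≤ 1) :
    1 - ∑ i ∈ s, a i ≤ ∏ i ∈ s, (1 - a i) := by
  classical
  induction s using Finset.induction_on with
  | empty => simp
  | insert i s hi ih =>
    rw [Finset.sum_insert hi, Finset.prod_insert hi]
    have h0' : ∀ j ∈ s, 0 ≤ a j := fun j hj => h0 j (Finset.mem_insert_of_mem hj)
    have h1' : ∀ j ∈ s, a j ≤ 1 := fun j hj => h1 j (Finset.mem_insert_of_mem hj)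
    have ih' := ih h0' h1'
    have hai0 := h0 i (Finset.mem_insert_self i s)
    have hai1 := h1 i (Finset.mem_insert_self i s)
    have hsum : 0 ≤ ∑ j ∈ s, a j := Finset.sum_nonneg h0'
    have hstep : (1 - a i) * (1 - ∑ j ∈ s, a j) ≤ (1 - a i) * ∏ j ∈ s, (1 - a j) :=
      mul_le_mul_of_nonneg_left ih' (by linarith)
    have e : (1 - a i) * (1 - ∑ j ∈ s, a j) = 1 - a i - ∑ j ∈ s, a j + a i * ∑ j ∈ s, a j := by
      ring
    have hnn : 0 ≤ a i * ∑ j ∈ s, a j := mul_nonneg hai0 hsum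
    linarith

/-- `σ(p^a)/p^a = (1 − p^{−(a+1)})·(1 − 1/p)⁻¹`. [folklore] -/
theorem sigma_prime_pow_div (p a : ℕ) (hp : p.Prime) :
    (σ 1 (p ^ a) : ℝ) / (p : ℝ) ^ a = (1 - ((p : ℝ) ^ (a + 1))⁻¹) * (1 - (p : ℝ)⁻¹)⁻¹ := by
  have hp0 : (0 : ℝ) < p := by exact_mod_cast hp.pos
  have hp1 : (1 : ℝ) < p := by exact_mod_cast hp.one_lt
  have hq : (p : ℝ) - 1 ≠ 0 := by linarith
  rw [ArithmeticFunction.sigma_one_apply_prime_pow hp]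
  push_cast
  have hS : ∑ i ∈ range (a + 1), (p : ℝ) ^ i = ((p : ℝ) ^ (a + 1) - 1) / ((p : ℝ) - 1) := by
    rw [eq_div_iff hq]
    exact geom_sum_mul _ _
  have hpa : (p : ℝ) ^ a ≠ 0 := by positivity
  have hpa1 : (p : ℝ) ^ (a + 1) ≠ 0 := by positivity
  have e1 : (1 - (p : ℝ)⁻¹)⁻¹ = p / ((p : ℝ) - 1) := by
    field_simp
  rw [hS, e1]
  field_simp
  ring

/-- **`σ(N)/N` for `N = lcm(1,…,n)`**: `σ(N)/N ≥ (1 − (1 + log n)/√(n+1)) · ∏_{p≤n}(1 − 1/p)⁻¹`.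
[folklore] -/
theorem sigma_lcmUpto_div_ge (n : ℕ) (hn : 1 ≤ n) :
    (∏ p ∈ Nat.primesLE n, (1 - (p : ℝ)⁻¹))⁻¹ * (1 - (1 + Real.log n) / √((n : ℝ) + 1)) ≤
      (σ 1 (Nat.lcmUpto n) : ℝ) / Nat.lcmUpto n := by
  classical
  set N := Nat.lcmUpto n with hN
  have hN0 : N ≠ 0 := Nat.lcmUpto_ne_zero n
  -- product formula
  have hprod : (σ 1 N : ℝ) / N =
      ∏ p ∈ Nat.primesLE n, (σ 1 (p ^ Nat.log p n) : ℝ) / (p : ℝ) ^ Nat.log p n := by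
    have h1 : σ 1 N = ∏ p ∈ Nat.primesLE n, σ 1 (p ^ Nat.log p n) := by
      have := ArithmeticFunction.IsMultiplicative.multiplicative_factorization (σ 1)
        ArithmeticFunction.isMultiplicative_sigma hN0
      rw [this, Finsupp.prod, Nat.support_factorization, Nat.primeFactors_lcmUpto]
      exact Finset.prod_congr rfl fun p hp => by
        rw [Nat.factorization_lcmUpto n (Nat.prime_of_mem_primesLE hp)]
    have h2 : (N : ℝ) = ∏ p ∈ Nat.primesLE n, (p : ℝ) ^ Nat.log p n := by
      rw [hN, Nat.lcmUpto_eq_prod_pow_log]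
      push_cast
      rfl
    rw [h1, h2, Nat.cast_prod, ← Finset.prod_div_distrib]
  rw [hprod]
  have hfac : ∀ p ∈ Nat.primesLE n, (σ 1 (p ^ Nat.log p n) : ℝ) / (p : ℝ) ^ Nat.log p n =
      (1 - ((p : ℝ) ^ (Nat.log p n + 1))⁻¹) * (1 - (p : ℝ)⁻¹)⁻¹ :=
    fun p hp => sigma_prime_pow_div p _ (Nat.prime_of_mem_primesLE hp)
  rw [Finset.prod_congr rfl hfac, Finset.prod_mul_distrib, Finset.prod_inv_distrib, mul_comm]
  have hM : 0 ≤ (∏ p ∈ Nat.primesLE n, (1 - (p : ℝ)⁻¹))⁻¹ :=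
    inv_nonneg.2 (mertens_prod_pos n).le
  refine mul_le_mul_of_nonneg_right ?_ hM
  -- `1 - (1 + log n)/√(n+1) ≤ 1 - ∑ p^{-(a+1)} ≤ ∏ (1 - p^{-(a+1)})`
  have hn0 : (0 : ℝ) < n := by exact_mod_cast hn
  have hsq : 0 < √((n : ℝ) + 1) := Real.sqrt_pos.2 (by linarith)
  have hterm : ∀ p ∈ Nat.primesLE n, ((p : ℝ) ^ (Nat.log p n + 1))⁻¹ ≤ (p : ℝ)⁻¹ / √((n : ℝ) + 1) := by
    intro p hp
    have hp' := Nat.prime_of_mem_primesLE hp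
    have hpn : p ≤ n := Nat.le_of_mem_primesLE hp
    have hp0 : (0 : ℝ) < p := by exact_mod_cast hp'.pos
    have ha : 1 ≤ Nat.log p n := Nat.log_pos hp'.one_lt hpn
    -- `p^{a+1} ≥ n+1` and `p^{a+1} ≥ p²`, hence `p^{a+1} ≥ p √(n+1)`
    have h1 : ((n : ℝ) + 1) ≤ (p : ℝ) ^ (Nat.log p n + 1) := by
      have := Nat.lt_pow_succ_log_self hp'.one_lt n
      exact_mod_cast this
    have h2 : (p : ℝ) ^ 2 ≤ (p : ℝ) ^ (Nat.log p n + 1) :=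
      pow_le_pow_right₀ (by exact_mod_cast hp'.one_lt.le) (by omega)
    have h3 : (p : ℝ) * √((n : ℝ) + 1) ≤ (p : ℝ) ^ (Nat.log p n + 1) := by
      -- squares: `p² (n+1) ≤ (p^{a+1})²`
      have h4 : ((p : ℝ) * √((n : ℝ) + 1)) ^ 2 ≤ ((p : ℝ) ^ (Nat.log p n + 1)) ^ 2 := by
        rw [mul_pow, Real.sq_sqrt (by linarith)]
        calc (p : ℝ) ^ 2 * ((n : ℝ) + 1) ≤ (p : ℝ) ^ (Nat.log p n + 1) * (p : ℝ) ^ (Nat.log p n + 1) :=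
              mul_le_mul h2 h1 (by linarith) (by positivity)
          _ = ((p : ℝ) ^ (Nat.log p n + 1)) ^ 2 := by ring
      calc (p : ℝ) * √((n : ℝ) + 1) = √(((p : ℝ) * √((n : ℝ) + 1)) ^ 2) :=
            (Real.sqrt_sq (by positivity)).symm
        _ ≤ √(((p : ℝ) ^ (Nat.log p n + 1)) ^ 2) := Real.sqrt_le_sqrt h4
        _ = (p : ℝ) ^ (Nat.log p n + 1) := Real.sqrt_sq (by positivity)
    rw [div_eq_mul_inv, ← mul_inv]
    exact inv_anti₀ (by positivity) h3
  have hsum : ∑ p ∈ Nat.primesLE n, ((p : ℝ) ^ (Nat.log p n + 1))⁻¹ ≤ (1 + Real.log n) / √((n : ℝ) + 1) := by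
    calc ∑ p ∈ Nat.primesLE n, ((p : ℝ) ^ (Nat.log p n + 1))⁻¹
        ≤ ∑ p ∈ Nat.primesLE n, (p : ℝ)⁻¹ / √((n : ℝ) + 1) := Finset.sum_le_sum hterm
      _ = (∑ p ∈ Nat.primesLE n, (p : ℝ)⁻¹) / √((n : ℝ) + 1) := by rw [Finset.sum_div]
      _ ≤ (∑ i ∈ Finset.Icc 1 n, (i : ℝ)⁻¹) / √((n : ℝ) + 1) := by
          refine div_le_div_of_nonneg_right ?_ hsq.le
          refine Finset.sum_le_sum_of_subset_of_nonneg ?_ (fun i _ _ => by positivity)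
          intro p hp
          exact Finset.mem_Icc.2 ⟨(Nat.prime_of_mem_primesLE hp).one_lt.le, Nat.le_of_mem_primesLE hp⟩
      _ ≤ (1 + Real.log n) / √((n : ℝ) + 1) := by
          refine div_le_div_of_nonneg_right ?_ hsq.le
          have h := harmonic_le_one_add_log n
          rw [harmonic_eq_sum_Icc] at h
          push_cast at h
          exact h
  have hW := one_sub_sum_le_prod (Nat.primesLE n) (fun p => ((p : ℝ) ^ (Nat.log p n + 1))⁻¹)
    (fun p _ => by positivity) (fun p hp => by
      have hp' := Nat.prime_of_mem_primesLE hp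
      exact inv_le_one_of_one_le₀ (one_le_pow₀ (by exact_mod_cast hp'.one_lt.le)))
  linarith

/-! ### Eventual estimates -/

/-- Eventually `θ(x) ≥ x/2` (from Mathlib's Chebyshev bound `θ(x) ≥ (x−1) log 2 − log(x+2) −
2√x log x` and `log x = o(√x)`). [folklore] -/
theorem eventually_theta_ge_half : ∀ᶠ x : ℝ in atTop, x / 2 ≤ θ x := by
  have h1 : ∀ᶠ x : ℝ in atTop, ‖Real.log x‖ ≤ 0.02 * ‖x‖ :=
    Real.isLittleO_log_id_atTop.def (by norm_num)
  have h2 : ∀ᶠ x : ℝ in atTop, ‖Real.log x‖ ≤ 0.05 * ‖x ^ (1 / 2 : ℝ)‖ :=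
    (isLittleO_log_rpow_atTop (by norm_num : (0 : ℝ) < 1 / 2)).def (by norm_num)
  filter_upwards [h1, h2, eventually_ge_atTop (100 : ℝ)] with x hx1 hx2 hx100
  have hx0 : 0 < x := by linarith
  have hlogx : 0 < Real.log x := Real.log_pos (by linarith)
  rw [Real.norm_eq_abs, Real.norm_eq_abs, abs_of_pos hlogx] at hx1 hx2
  rw [abs_of_pos hx0] at hx1
  rw [abs_of_pos (Real.rpow_pos_of_pos hx0 _), ← Real.sqrt_eq_rpow] at hx2
  have hθ := Chebyshev.theta_ge' (x := x) (by linarith)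
  have hlog2 := Real.log_two_gt_d9
  -- `log(x+2) ≤ log 2 + log x`
  have h3 : Real.log (x + 2) ≤ Real.log 2 + Real.log x := by
    rw [← Real.log_mul (by norm_num) hx0.ne']
    exact Real.log_le_log (by linarith) (by linarith)
  have hlog2' := Real.log_two_lt_d9
  -- `2 √x log x ≤ 0.1 x`
  have h4 : 2 * √x * Real.log x ≤ 0.1 * x := by
    have hs : √x * √x = x := Real.mul_self_sqrt hx0.le
    have := mul_le_mul_of_nonneg_left hx2 (by positivity : (0 : ℝ) ≤ 2 * √x)
    calc 2 * √x * Real.log x ≤ 2 * √x * (0.05 * √x) := this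
      _ = 0.1 * (√x * √x) := by ring
      _ = 0.1 * x := by rw [hs]
  have h5 : (x - 1) * 0.6931471803 ≤ (x - 1) * Real.log 2 :=
    mul_le_mul_of_nonneg_left hlog2.le (by linarith)
  linarith

/-- Eventually `(2 + 6 log x)/√x ≤ c x^{−b}` and `c x^{−b} ≤ 1`, for `0 < b < 1/2`, `c > 0`
(`log x = o(x^{1/2−b})`, `x^{−b} → 0`). [folklore] -/
theorem eventually_gain_dominates {b c : ℝ} (hb0 : 0 < b) (hb : b < 1 / 2) (hc : 0 < c) :
    ∀ᶠ x : ℝ in atTop, (2 + 6 * Real.log x) / √x ≤ c * x ^ (-b) ∧ c * x ^ (-b) ≤ 1 := by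
  have hr : 0 < 1 / 2 - b := by linarith
  have h1 : ∀ᶠ x : ℝ in atTop, ‖Real.log x‖ ≤ c / 8 * ‖x ^ (1 / 2 - b)‖ :=
    (isLittleO_log_rpow_atTop hr).def (by positivity)
  have h2 : ∀ᶠ x : ℝ in atTop, x ^ (-b) < 1 / c :=
    (tendsto_order.1 (tendsto_rpow_neg_atTop hb0)).2 _ (by positivity)
  filter_upwards [h1, h2, eventually_ge_atTop (3 : ℝ)] with x hx1 hx2 hx3
  have hx0 : 0 < x := by linarith
  have hlogx : 1 ≤ Real.log x := by
    rw [← Real.log_exp 1]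
    refine Real.log_le_log (Real.exp_pos 1) ?_
    have := Real.exp_one_lt_d9
    linarith
  rw [Real.norm_eq_abs, Real.norm_eq_abs, abs_of_pos (by linarith),
    abs_of_pos (Real.rpow_pos_of_pos hx0 _)] at hx1
  constructor
  · -- `(2 + 6 log x)/√x ≤ 8 log x/√x ≤ c x^{1/2-b}/x^{1/2} = c x^{-b}`
    have hsqrt : √x = x ^ (1 / 2 : ℝ) := Real.sqrt_eq_rpow x
    have hsx : 0 < √x := Real.sqrt_pos.2 hx0
    rw [div_le_iff₀ hsx]
    have e1 : c * x ^ (-b) * √x = c * x ^ (1 / 2 - b) := by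
      rw [hsqrt, mul_assoc, ← Real.rpow_add hx0]
      ring_nf
    rw [e1]
    linarith
  · have := mul_lt_mul_of_pos_left hx2 hc
    rw [mul_one_div_cancel hc.ne'] at this
    exact this.le

end RobinOscillation

open RobinOscillation in
/-- **Robin's criterion, converse half, from Nicolas's `Ω`-theorem** (Robin 1984, §4, Prop. 1,
via `N = lcm(1,…,⌊x⌋)` instead of colossally abundant numbers): granted
`Nicolas1983_logf_omega`, if Robin's inequality `σ(n) < e^γ n log log n` holds for every
`n > 5040` then the Riemann hypothesis holds. [cite: Robin1984, §4 Prop. 1] -/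
theorem robinInequality_imp_riemannHypothesis_of_nicolas (hΩ : Nicolas1983_logf_omega)
    (hR : ∀ n : ℕ, 5040 < n → robinInequality n) : RiemannHypothesis := by
  by_contra hRH
  obtain ⟨b, hb0, hb12, ⟨c, hc, hfreq⟩, -⟩ := hΩ hRH
  have hev := (eventually_theta_ge_half).and
    ((eventually_gain_dominates hb0 hb12 hc).and (eventually_ge_atTop (5041 : ℝ)))
  obtain ⟨x, hfx, hθx, ⟨hgain, hcx⟩, hx⟩ := (hfreq.and_eventually hev).exists
  -- the number `N = lcm(1, …, ⌊x⌋)`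
  set n := ⌊x⌋₊ with hn
  have hx0 : 0 < x := by linarith
  have hnx : (n : ℝ) ≤ x := Nat.floor_le hx0.le
  have hxn : x < n + 1 := Nat.lt_floor_add_one x
  have hn5041 : 5041 ≤ n := Nat.le_floor hx
  have hn1 : 1 ≤ n := le_trans (by norm_num) hn5041
  have hnR : (5041 : ℝ) ≤ n := by exact_mod_cast hn5041
  set N := Nat.lcmUpto n with hNdef
  have hN0 : N ≠ 0 := Nat.lcmUpto_ne_zero n
  have hN5040 : 5040 < N := by
    have hd : 5041 ∣ N := Finset.dvd_lcm (Finset.mem_Icc.2 ⟨by norm_num, hn5041⟩)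
    have := Nat.le_of_dvd (Nat.pos_of_ne_zero hN0) hd
    omega
  have hRN := hR N hN5040
  unfold robinInequality at hRN
  -- notation
  have hθ_eq : θ x = θ n := Chebyshev.theta_eq_theta_coe_floor x
  have hψ_eq : ψ x = Real.log N := by
    rw [Chebyshev.psi_eq_psi_coe_floor x, hNdef, ← Chebyshev.psi_eq_log_lcmUpto]
  set T := θ x with hT
  set M := (∏ p ∈ Nat.primesLE n, (1 - (p : ℝ)⁻¹))⁻¹ with hM
  have hx3 : (3 : ℝ) ≤ x := by linarith
  have hT1 : 1 < T := one_lt_theta hx3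
  have hTx : x / 2 ≤ T := hθx
  have hlogT : 1 ≤ Real.log T := by
    rw [← Real.log_exp 1]
    refine Real.log_le_log (Real.exp_pos 1) ?_
    have := Real.exp_one_lt_d9
    linarith
  have hlogT0 : 0 < Real.log T := by linarith
  have hprod0 : 0 < ∏ p ∈ Nat.primesLE n, (1 - (p : ℝ)⁻¹) := mertens_prod_pos n
  have hM0 : 0 < M := inv_pos.2 hprod0
  -- (1) from `log f(x) ≤ -c x^{-b}`: `M ≥ e^γ log T · exp(c x^{-b})`
  have hF : nicolasF x = rexp eulerMascheroniConstant * Real.log T * M⁻¹ := by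
    simp only [hM, hT, inv_inv, hn]
    rfl
  have hFpos : 0 < nicolasF x := nicolasF_pos hx3
  have h1 : rexp eulerMascheroniConstant * Real.log T * rexp (c * x ^ (-b)) ≤ M := by
    have h2 : nicolasF x ≤ rexp (-(c * x ^ (-b))) := by
      rw [← Real.exp_log hFpos]
      exact Real.exp_le_exp.2 (by linarith)
    rw [hF] at h2
    -- multiply by `M · exp(c x^{-b})`
    have h3 := mul_le_mul_of_nonneg_right h2 (by positivity : (0 : ℝ) ≤ M * rexp (c * x ^ (-b)))
    have e1 : rexp eulerMascheroniConstant * Real.log T * M⁻¹ * (M * rexp (c * x ^ (-b))) =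
        rexp eulerMascheroniConstant * Real.log T * rexp (c * x ^ (-b)) := by
      field_simp
    have e2 : rexp (-(c * x ^ (-b))) * (M * rexp (c * x ^ (-b))) = M := by
      rw [mul_comm M, ← mul_assoc, ← Real.exp_add]
      simp
    rw [e1, e2] at h3
    exact h3
  -- (2) `σ(N)/N ≥ M (1 - η)`, `η = (1 + log n)/√(n+1) ≤ (1 + log x)/√x =: η'`
  have h4 := sigma_lcmUpto_div_ge n hn1
  set η' := (1 + Real.log x) / √x with hη'
  have hsx : 0 < √x := Real.sqrt_pos.2 hx0
  have hη : (1 + Real.log n) / √((n : ℝ) + 1) ≤ η' := by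
    have hn0 : (0 : ℝ) < n := by linarith
    have hlogn : Real.log n ≤ Real.log x := Real.log_le_log hn0 hnx
    have hlogn0 : 0 ≤ Real.log n := Real.log_nonneg (by linarith)
    have hsq : √x ≤ √((n : ℝ) + 1) := Real.sqrt_le_sqrt hxn.le
    calc (1 + Real.log n) / √((n : ℝ) + 1) ≤ (1 + Real.log n) / √x :=
          div_le_div_of_nonneg_left (by linarith) hsx hsq
      _ ≤ η' := div_le_div_of_nonneg_right (by linarith) hsx.le
  -- from the eventual bounds: `2η' + 4 log x/√x ≤ c x^{-b} ≤ 1`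
  have hgain' : 2 * η' + 4 * Real.log x / √x ≤ c * x ^ (-b) := by
    have e1 : 2 * η' + 4 * Real.log x / √x = (2 + 6 * Real.log x) / √x := by
      rw [hη']
      field_simp
      ring
    rw [e1]
    exact hgain
  have hlogx0 : 0 < Real.log x := Real.log_pos (by linarith)
  have hη'0 : 0 ≤ η' := by positivity
  have hη'1 : η' ≤ 1 / 2 := by
    have : 0 ≤ 4 * Real.log x / √x := by positivity
    linarith
  have h5 : M * (1 - η') ≤ (σ 1 N : ℝ) / N := by
    calc M * (1 - η') ≤ M * (1 - (1 + Real.log n) / √((n : ℝ) + 1)) := by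
          gcongr
      _ ≤ (σ 1 N : ℝ) / N := h4
  -- (3) `log log N = log ψ(x) ≤ log T + 4 log x/√x`
  have hψT : ψ x ≤ T + 2 * √x * Real.log x := by
    have := Chebyshev.psi_sub_theta_le (x := x) (by linarith)
    linarith
  have hψpos : 0 < ψ x := lt_of_lt_of_le (by linarith) (Chebyshev.theta_le_psi x)
  have h6 : Real.log (Real.log N) ≤ Real.log T + 4 * Real.log x / √x := by
    rw [← hψ_eq]
    have hT0 : 0 < T := by linarith
    have h7 : Real.log (ψ x) - Real.log T ≤ (ψ x - T) / T := by
      rw [← Real.log_div hψpos.ne' hT0.ne']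
      have := Real.log_le_sub_one_of_pos (show 0 < ψ x / T by positivity)
      have e1 : ψ x / T - 1 = (ψ x - T) / T := by field_simp
      linarith
    have hs : √x * √x = x := Real.mul_self_sqrt hx0.le
    have h8 : (ψ x - T) / T ≤ 4 * Real.log x / √x := by
      rw [div_le_div_iff₀ hT0 hsx]
      have i1 : (ψ x - T) * √x ≤ (2 * √x * Real.log x) * √x :=
        mul_le_mul_of_nonneg_right (by linarith) hsx.le
      have i2 : (2 * √x * Real.log x) * √x = 2 * Real.log x * x := by
        rw [show (2 * √x * Real.log x) * √x = 2 * Real.log x * (√x * √x) by ring, hs]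
      have i3 : 2 * Real.log x * x ≤ 4 * Real.log x * T := by nlinarith
      linarith
    linarith
  -- (4) combine: `σ(N)/N ≥ e^γ (log T + 4 log x/√x) ≥ e^γ log log N`
  have hexp : 1 + c * x ^ (-b) ≤ rexp (c * x ^ (-b)) := by
    have := Real.add_one_le_exp (c * x ^ (-b))
    linarith
  have hcx0 : 0 ≤ c * x ^ (-b) := by positivity
  have h9 : Real.log T + 4 * Real.log x / √x ≤ Real.log T * rexp (c * x ^ (-b)) * (1 - η') := by
    -- `log T · e^{c x^{-b}} (1-η') ≥ log T (1 + c x^{-b})(1 - η') ≥ log T (1 + c x^{-b} - 2η')`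
    have s1 : Real.log T * (1 + c * x ^ (-b)) * (1 - η') ≤
        Real.log T * rexp (c * x ^ (-b)) * (1 - η') := by
      have : 0 ≤ 1 - η' := by linarith
      gcongr
    have s2 : Real.log T * (1 + c * x ^ (-b) - 2 * η') ≤
        Real.log T * (1 + c * x ^ (-b)) * (1 - η') := by
      have e : (1 + c * x ^ (-b)) * (1 - η') = 1 + c * x ^ (-b) - η' - c * x ^ (-b) * η' := by ring
      rw [mul_assoc, e]
      refine mul_le_mul_of_nonneg_left ?_ hlogT0.le
      have : c * x ^ (-b) * η' ≤ 1 * η' := mul_le_mul_of_nonneg_right hcx hη'0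
      linarith
    have s3 : Real.log T + 4 * Real.log x / √x ≤ Real.log T * (1 + c * x ^ (-b) - 2 * η') := by
      have hpos : 0 ≤ c * x ^ (-b) - 2 * η' := by
        have h0 : 0 ≤ 4 * Real.log x / √x := by positivity
        linarith
      have hm : 1 * (c * x ^ (-b) - 2 * η') ≤ Real.log T * (c * x ^ (-b) - 2 * η') :=
        mul_le_mul_of_nonneg_right hlogT hpos
      calc Real.log T + 4 * Real.log x / √x ≤ Real.log T + 1 * (c * x ^ (-b) - 2 * η') := by
            linarith
        _ ≤ Real.log T + Real.log T * (c * x ^ (-b) - 2 * η') := by linarith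
        _ = Real.log T * (1 + c * x ^ (-b) - 2 * η') := by ring
    linarith
  have hfinal : rexp eulerMascheroniConstant * Real.log (Real.log N) ≤ (σ 1 N : ℝ) / N := by
    calc rexp eulerMascheroniConstant * Real.log (Real.log N)
        ≤ rexp eulerMascheroniConstant * (Real.log T + 4 * Real.log x / √x) := by gcongr
      _ ≤ rexp eulerMascheroniConstant * (Real.log T * rexp (c * x ^ (-b)) * (1 - η')) := by gcongr
      _ = (rexp eulerMascheroniConstant * Real.log T * rexp (c * x ^ (-b))) * (1 - η') := by ring
      _ ≤ M * (1 - η') := mul_le_mul_of_nonneg_right h1 (by linarith)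
      _ ≤ (σ 1 N : ℝ) / N := h5
  -- contradiction with Robin's inequality at `N`
  have hNpos : (0 : ℝ) < N := by exact_mod_cast Nat.pos_of_ne_zero hN0
  have : (σ 1 N : ℝ) / N < rexp eulerMascheroniConstant * Real.log (Real.log N) := by
    rw [div_lt_iff₀ hNpos]
    calc (σ 1 N : ℝ) < rexp eulerMascheroniConstant * N * Real.log (Real.log N) := hRN
      _ = rexp eulerMascheroniConstant * Real.log (Real.log N) * N := by ring
  linarith

open RobinOscillation in
/-- **Robin's `Ω₊`-theorem from Nicolas's** (Robin 1984, §4 Prop. 1, as quoted by Lagarias 2002,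
Prop. 3.2 = `Robin1984_sigma_oscillation`; here derived from `Nicolas1983_logf_omega` with
`β = b`, `C = c/8`, at the numbers `N = lcm(1,…,⌊x⌋)`): if RH fails there are `0 < β < 1/2`
and `C > 0` with `σ(n) ≥ e^γ n log log n + C n log log n/(log n)^β` for infinitely many `n`.
[cite: Robin1984, §4 Prop. 1] -/
theorem Robin1984_sigma_oscillation_of_nicolas (hΩ : Nicolas1983_logf_omega) :
    Robin1984_sigma_oscillation := by
  intro hRH
  obtain ⟨b, hb0, hb12, ⟨c, hc, hfreq⟩, -⟩ := hΩ hRH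
  have hc2 : 0 < c / 2 := by positivity
  refine ⟨b, c / 8, hb0, hb12, by positivity, ?_⟩
  rw [Filter.frequently_atTop]
  intro K
  have hev := (eventually_theta_ge_half).and
    ((eventually_gain_dominates hb0 hb12 hc2).and
      ((eventually_gain_dominates hb0 hb12 hc).and (eventually_ge_atTop ((K : ℝ) + 5041))))
  obtain ⟨x, hfx, hθx, ⟨hgain, -⟩, ⟨-, hcx⟩, hx⟩ := (hfreq.and_eventually hev).exists
  set n := ⌊x⌋₊ with hn
  have hK0 : (0 : ℝ) ≤ K := Nat.cast_nonneg K
  have hx0 : 0 < x := by linarith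
  have hnx : (n : ℝ) ≤ x := Nat.floor_le hx0.le
  have hxn : x < n + 1 := Nat.lt_floor_add_one x
  have hnK : K + 5041 ≤ n := Nat.le_floor (by push_cast; linarith)
  have hn1 : 1 ≤ n := le_trans (by norm_num) hnK
  have hnR : (5041 : ℝ) ≤ n := by exact_mod_cast (le_trans (Nat.le_add_left _ _) hnK)
  set N := Nat.lcmUpto n with hNdef
  have hN0 : N ≠ 0 := Nat.lcmUpto_ne_zero n
  have hnN : n ≤ N := Nat.le_of_dvd (Nat.pos_of_ne_zero hN0)
    (Finset.dvd_lcm (Finset.mem_Icc.2 ⟨hn1, le_rfl⟩))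
  refine ⟨N, by omega, ?_⟩
  -- notation and basic facts (as in the qualitative proof)
  have hψ_eq : ψ x = Real.log N := by
    rw [Chebyshev.psi_eq_psi_coe_floor x, hNdef, ← Chebyshev.psi_eq_log_lcmUpto]
  set T := θ x with hT
  set M := (∏ p ∈ Nat.primesLE n, (1 - (p : ℝ)⁻¹))⁻¹ with hM
  have hx3 : (3 : ℝ) ≤ x := by linarith
  have hT1 : 1 < T := one_lt_theta hx3
  have hTx : x / 2 ≤ T := hθx
  have hlogT : 1 ≤ Real.log T := by
    rw [← Real.log_exp 1]
    refine Real.log_le_log (Real.exp_pos 1) ?_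
    have := Real.exp_one_lt_d9
    linarith
  have hlogT0 : 0 < Real.log T := by linarith
  have hprod0 : 0 < ∏ p ∈ Nat.primesLE n, (1 - (p : ℝ)⁻¹) := mertens_prod_pos n
  have hM0 : 0 < M := inv_pos.2 hprod0
  have hF : nicolasF x = rexp eulerMascheroniConstant * Real.log T * M⁻¹ := by
    simp only [hM, hT, inv_inv, hn]
    rfl
  have hFpos : 0 < nicolasF x := nicolasF_pos hx3
  have h1 : rexp eulerMascheroniConstant * Real.log T * rexp (c * x ^ (-b)) ≤ M := by
    have h2 : nicolasF x ≤ rexp (-(c * x ^ (-b))) := by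
      rw [← Real.exp_log hFpos]
      exact Real.exp_le_exp.2 (by linarith)
    rw [hF] at h2
    have h3 := mul_le_mul_of_nonneg_right h2 (by positivity : (0 : ℝ) ≤ M * rexp (c * x ^ (-b)))
    have e1 : rexp eulerMascheroniConstant * Real.log T * M⁻¹ * (M * rexp (c * x ^ (-b))) =
        rexp eulerMascheroniConstant * Real.log T * rexp (c * x ^ (-b)) := by
      field_simp
    have e2 : rexp (-(c * x ^ (-b))) * (M * rexp (c * x ^ (-b))) = M := by
      rw [mul_comm M, ← mul_assoc, ← Real.exp_add]
      simp
    rw [e1, e2] at h3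
    exact h3
  have h4 := sigma_lcmUpto_div_ge n hn1
  set η' := (1 + Real.log x) / √x with hη'
  have hsx : 0 < √x := Real.sqrt_pos.2 hx0
  have hη : (1 + Real.log n) / √((n : ℝ) + 1) ≤ η' := by
    have hn0 : (0 : ℝ) < n := by linarith
    have hlogn : Real.log n ≤ Real.log x := Real.log_le_log hn0 hnx
    have hlogn0 : 0 ≤ Real.log n := Real.log_nonneg (by linarith)
    have hsq : √x ≤ √((n : ℝ) + 1) := Real.sqrt_le_sqrt hxn.le
    calc (1 + Real.log n) / √((n : ℝ) + 1) ≤ (1 + Real.log n) / √x :=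
          div_le_div_of_nonneg_left (by linarith) hsx hsq
      _ ≤ η' := div_le_div_of_nonneg_right (by linarith) hsx.le
  -- eventual bounds: `2η' + 4 log x/√x ≤ (c/2) x^{-b}` and `c x^{-b} ≤ 1`
  have hgain' : 2 * η' + 4 * Real.log x / √x ≤ c / 2 * x ^ (-b) := by
    have e1 : 2 * η' + 4 * Real.log x / √x = (2 + 6 * Real.log x) / √x := by
      rw [hη']
      field_simp
      ring
    rw [e1]
    exact hgain
  have hlogx0 : 0 < Real.log x := Real.log_pos (by linarith)
  have hη'0 : 0 ≤ η' := by positivity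
  have h4L : 0 ≤ 4 * Real.log x / √x := by positivity
  have hxb0 : 0 ≤ x ^ (-b) := (Real.rpow_pos_of_pos hx0 _).le
  have hcxb0 : 0 ≤ c * x ^ (-b) := by positivity
  have hη'1 : η' ≤ 1 / 2 := by linarith
  have h5 : M * (1 - η') ≤ (σ 1 N : ℝ) / N := by
    calc M * (1 - η') ≤ M * (1 - (1 + Real.log n) / √((n : ℝ) + 1)) := by gcongr
      _ ≤ (σ 1 N : ℝ) / N := h4
  -- `log log N ≤ log T + 4 log x/√x`
  have hψT : ψ x ≤ T + 2 * √x * Real.log x := by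
    have := Chebyshev.psi_sub_theta_le (x := x) (by linarith)
    linarith
  have hψpos : 0 < ψ x := lt_of_lt_of_le (by linarith) (Chebyshev.theta_le_psi x)
  have hT0 : 0 < T := by linarith
  have h6 : Real.log (Real.log N) ≤ Real.log T + 4 * Real.log x / √x := by
    rw [← hψ_eq]
    have h7 : Real.log (ψ x) - Real.log T ≤ (ψ x - T) / T := by
      rw [← Real.log_div hψpos.ne' hT0.ne']
      have := Real.log_le_sub_one_of_pos (show 0 < ψ x / T by positivity)
      have e1 : ψ x / T - 1 = (ψ x - T) / T := by field_simp
      linarith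
    have hs : √x * √x = x := Real.mul_self_sqrt hx0.le
    have h8 : (ψ x - T) / T ≤ 4 * Real.log x / √x := by
      rw [div_le_div_iff₀ hT0 hsx]
      have i1 : (ψ x - T) * √x ≤ (2 * √x * Real.log x) * √x :=
        mul_le_mul_of_nonneg_right (by linarith) hsx.le
      have i2 : (2 * √x * Real.log x) * √x = 2 * Real.log x * x := by
        rw [show (2 * √x * Real.log x) * √x = 2 * Real.log x * (√x * √x) by ring, hs]
      have i3 := mul_le_mul_of_nonneg_left hTx hlogx0.le
      have i4 : 2 * Real.log x * x = 4 * (Real.log x * (x / 2)) := by ring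
      have i5 : 4 * Real.log x * T = 4 * (Real.log x * T) := by ring
      linarith
    linarith
  -- lower bound: `σ(N)/N ≥ e^γ log T (1 + c x^{-b} - 2η')`
  have hexp : 1 + c * x ^ (-b) ≤ rexp (c * x ^ (-b)) := by
    have := Real.add_one_le_exp (c * x ^ (-b))
    linarith
  have h9 : rexp eulerMascheroniConstant * (Real.log T * (1 + c * x ^ (-b) - 2 * η')) ≤
      (σ 1 N : ℝ) / N := by
    have s1 : Real.log T * (1 + c * x ^ (-b)) * (1 - η') ≤
        Real.log T * rexp (c * x ^ (-b)) * (1 - η') := by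
      have : 0 ≤ 1 - η' := by linarith
      gcongr
    have s2 : Real.log T * (1 + c * x ^ (-b) - 2 * η') ≤
        Real.log T * (1 + c * x ^ (-b)) * (1 - η') := by
      have e : (1 + c * x ^ (-b)) * (1 - η') = 1 + c * x ^ (-b) - η' - c * x ^ (-b) * η' := by ring
      rw [mul_assoc, e]
      refine mul_le_mul_of_nonneg_left ?_ hlogT0.le
      have : c * x ^ (-b) * η' ≤ 1 * η' := mul_le_mul_of_nonneg_right hcx hη'0
      linarith
    have s3 : rexp eulerMascheroniConstant * (Real.log T * (1 + c * x ^ (-b) - 2 * η')) ≤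
        rexp eulerMascheroniConstant * (Real.log T * rexp (c * x ^ (-b)) * (1 - η')) :=
      mul_le_mul_of_nonneg_left (s2.trans s1) (Real.exp_pos _).le
    calc rexp eulerMascheroniConstant * (Real.log T * (1 + c * x ^ (-b) - 2 * η'))
        ≤ rexp eulerMascheroniConstant * (Real.log T * rexp (c * x ^ (-b)) * (1 - η')) := s3
      _ = (rexp eulerMascheroniConstant * Real.log T * rexp (c * x ^ (-b))) * (1 - η') := by ring
      _ ≤ M * (1 - η') := mul_le_mul_of_nonneg_right h1 (by linarith)
      _ ≤ (σ 1 N : ℝ) / N := h5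
  -- the gain: `σ(N)/N - e^γ log log N ≥ e^γ (c/2) x^{-b} log T`
  have h10 : rexp eulerMascheroniConstant * Real.log (Real.log N) +
      rexp eulerMascheroniConstant * (c / 2 * x ^ (-b) * Real.log T) ≤ (σ 1 N : ℝ) / N := by
    have a1 : 4 * Real.log x / √x + c / 2 * x ^ (-b) ≤ c * x ^ (-b) - 2 * η' := by linarith
    have a2 : Real.log T * (4 * Real.log x / √x + c / 2 * x ^ (-b)) ≤
        Real.log T * (c * x ^ (-b) - 2 * η') := mul_le_mul_of_nonneg_left a1 hlogT0.le
    have a3 : 1 * (4 * Real.log x / √x) ≤ Real.log T * (4 * Real.log x / √x) :=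
      mul_le_mul_of_nonneg_right hlogT h4L
    have e1 : Real.log T * (4 * Real.log x / √x + c / 2 * x ^ (-b)) =
        Real.log T * (4 * Real.log x / √x) + c / 2 * x ^ (-b) * Real.log T := by ring
    have e2 : Real.log T * (1 + c * x ^ (-b) - 2 * η') =
        Real.log T + Real.log T * (c * x ^ (-b) - 2 * η') := by ring
    have hstep : Real.log (Real.log N) + c / 2 * x ^ (-b) * Real.log T ≤
        Real.log T * (1 + c * x ^ (-b) - 2 * η') := by linarith
    have := mul_le_mul_of_nonneg_left hstep (Real.exp_pos eulerMascheroniConstant).le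
    rw [mul_add] at this
    exact this.trans h9
  -- compare `C log log N/(log N)^b` with the gain
  have hNpos : (0 : ℝ) < N := by exact_mod_cast Nat.pos_of_ne_zero hN0
  have hlogN : T ≤ Real.log N := by rw [← hψ_eq]; exact Chebyshev.theta_le_psi x
  have hlogN0 : 0 < Real.log N := by linarith
  have hllN : Real.log (Real.log N) ≤ 2 * Real.log T := by
    have : c / 2 * x ^ (-b) ≤ 1 := by linarith
    linarith
  have hllN0 : 0 ≤ Real.log (Real.log N) := by
    have : 1 ≤ Real.log N := by linarith
    exact Real.log_nonneg this
  -- `(log N)^{-b} ≤ (x/2)^{-b} = 2^b x^{-b} ≤ 2 x^{-b}`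
  have hpow : (Real.log N) ^ (-b) ≤ 2 * x ^ (-b) := by
    have h1' : (Real.log N) ^ (-b) ≤ (x / 2) ^ (-b) :=
      Real.rpow_le_rpow_of_nonpos (by positivity) (by linarith) (by linarith)
    have h2' : (x / 2 : ℝ) ^ (-b) = 2 ^ b * x ^ (-b) := by
      rw [Real.div_rpow hx0.le (by norm_num), Real.rpow_neg (by norm_num : (0:ℝ) ≤ 2),
        div_eq_mul_inv, inv_inv, mul_comm]
    have h3' : (2 : ℝ) ^ b ≤ 2 := by
      calc (2 : ℝ) ^ b ≤ 2 ^ (1 : ℝ) := Real.rpow_le_rpow_of_exponent_le (by norm_num) (by linarith)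
        _ = 2 := Real.rpow_one 2
    rw [h2'] at h1'
    exact h1'.trans (mul_le_mul_of_nonneg_right h3' hxb0)
  have hexpγ : 1 ≤ rexp eulerMascheroniConstant := by
    have := Real.one_half_lt_eulerMascheroniConstant
    exact Real.one_le_exp (by linarith)
  have hC : c / 8 * Real.log (Real.log N) / Real.log N ^ b ≤
      rexp eulerMascheroniConstant * (c / 2 * x ^ (-b) * Real.log T) := by
    have e1 : c / 8 * Real.log (Real.log N) / Real.log N ^ b =
        c / 8 * Real.log (Real.log N) * Real.log N ^ (-b) := by
      rw [Real.rpow_neg hlogN0.le, div_eq_mul_inv]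
    rw [e1]
    calc c / 8 * Real.log (Real.log N) * Real.log N ^ (-b)
        ≤ c / 8 * (2 * Real.log T) * (2 * x ^ (-b)) := by
          gcongr
      _ = 1 * (c / 2 * x ^ (-b) * Real.log T) := by ring
      _ ≤ rexp eulerMascheroniConstant * (c / 2 * x ^ (-b) * Real.log T) :=
          mul_le_mul_of_nonneg_right hexpγ (by positivity)
  -- conclude
  have hmain : rexp eulerMascheroniConstant * Real.log (Real.log N) +
      c / 8 * Real.log (Real.log N) / Real.log N ^ b ≤ (σ 1 N : ℝ) / N := by linarith
  rw [le_div_iff₀ hNpos] at hmain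
  calc rexp eulerMascheroniConstant * N * Real.log (Real.log N) +
        c / 8 * N * Real.log (Real.log N) / Real.log N ^ b
      = (rexp eulerMascheroniConstant * Real.log (Real.log N) +
          c / 8 * Real.log (Real.log N) / Real.log N ^ b) * N := by ring
    _ ≤ (σ 1 N : ℝ) := hmain

end Literature.NumberTheory.LFunctions

end
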